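import Literature.MathematicalPhysics.QuantumFieldTheory.MullerSchiemann1987.MS87WilsonAction
import Literature.MathematicalPhysics.QuantumFieldTheory.MullerSchiemann1987.MS87NormalFamilyBound
import HarnessLib

/-!
# Müller–Schiemann, *Continuum limit of a hierarchical SU(2) lattice gauge theory in 4 dimensions*
# (CMP 110, 1987), THE UNIFORM STRIP BOUND (6.16) OF THE PROOF OF THEOREM 2 PART 4) FOR THE WILSON ACTION AT THE
# INITIAL SCALE: both regimes — small field from (A₃) (part 2)) and large field from (A₂) (part 3)) — DISCHARGED for
# `h_W(z) = exp{2β(cos z − 1)}`, and the assembled `|h_W(x + iy)| ≤ exp{(1 + ε′)(κ/2)²β^{1−2α}}` on `|x| ≤ π`,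
# `|y| < (κ/2)β^{−α}` (theorems only; no definition, no named fact)

statement-level skeleton of published theorems with citation tags; proofs where landed; nothing here is a claim about the Yang–Mills mass gap

**Citation header (reproduction of PUBLISHED work).** V. F. Müller, J. Schiemann, *Continuum limit of a hierarchical
SU(2) lattice gauge theory in 4 dimensions*, Commun. Math. Phys. **110** (1987) 261–286, doi 10.1007/BF01207367
[MullerSchiemann1987]; (2.5), (2.10) p.264, (A₂)–(A₃) p.267, p.268 L.30–31, Theorem 2 parts 2)–4) and (6.16) p.281,
p.282 L.1–2, (6.17)–(6.18) p.282 (held Project Euclid scan `paper:url-96df5da18d4c`; displays read by this seat on its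
own 3× page renders `run/shared/lean/pub/lit-balaban/lit-balaban-p12/renders-cmp110ms/ms87-cmp110-pdfp004,007,008,
021,022-journalp264,267,268,281,282-x3.png`). Lean lane of the lit-balaban YM LIT SWEEP CONTEXT row X1 (register
level; zero weight for any token of that table); the model is the `d = 4` HIERARCHICAL `SU(2)` gauge model, NOT
lattice Yang–Mills.

**What the paper prints (p.281 L.36 – p.282 L.2).** *«In order to prove 4) we first observe for given cutoff N and
scale n the bound, valid for |y| < (κ/2)(β_N^{(−n)})^{−α}, |h_N^{(−n)}(x + iy)| < exp{(1 + ε′)(κ/2)²(β_N^{(−n)})^{1−2α}}.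
(6.16) It follows directly from 2) and 3) of the theorem, the small ε′ > 0 absorbs contributions of lower order in
the case 2).»* — part 2) is (A₃) («h(z) = exp{−V(z)}, V(z) = βz² + ½λz⁴ + ⅓σz⁶ + Ṽ(z), |Ṽ(z)| < Dβ⁻²» in
`|z| < β^{−α}`), part 3) is the (A₂)-type bound `|h(z)| < exp{βy² − pβ^{1−2α}}` for `|z| > β^{−α}`, `|x| ≤ π`,
`|y| < (κ/2)β^{−α}`; for the Wilson action (2.5) at the initial scale `h = h_W`, `h_W(z) = g̃_W(e₀, z) = exp{2β(cos z −
1)}` with «W: λ = −β/3!, σ = β/5!» (p.281 L.17) and «(A₂) and (A₃) … are easily seen to hold in the case of the Wilson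
action» (p.268 L.30–31).

**What this file proves (kernel-checked, 0 sorry, standard axioms; no definition, no named fact).** The two regimes
of (6.16) are the sibling `MS87NormalFamilyBound`'s model-free `eq616_small` / `eq616_large` / `eq616`; this file
DISCHARGES their hypotheses for `h_W`:
* §1 `|h_W(x + iy)| = exp{2β(cos x cosh y − 1)}` (`norm_hW`).
* §2 **THE LARGE-FIELD REGIME FOR (W), DIRECTLY ON THE STRIP** (`large_core`, β-free; `hW_large`): for `1 < κ`,
  `0 ≤ p < 1 − κ²/4`, `0 < ϱ ≤ ϱ₀ := min(½, (1 − κ²/4 − p)/3)`, `|x| ≤ π`, `|y| < (κ/2)ϱ` and `x² + y² ≥ ϱ²`: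
  `2(cos x cosh y − 1) < y² − pϱ²`, hence `|h_W(x + iy)| < exp{βy² − pβϱ²}` for every `β > 0` — part 3)'s bound for
  `h_W` on the whole strip `|x| ≤ π` (the sibling `WilsonAction.thm2_part3_wilson` covers `|z| < 1` through the
  central-angle region (2.18); here `1 − cos x ≥ x²/2 − (5/96)x⁴` replaces `θ`).
* §3 **THE SMALL-FIELD REGIME FOR (W)** (`hW_small`): for `β ≥ 1`, `α ≥ 3/8`, `|z| ≤ β^{−α}`,
  `(Im z)² ≤ (κ/2)²β^{−2α}`: `|h_W(z)| ≤ exp{(κ/2)²β^{1−2α} + (1/12 + 1/360)β^{1−4α} + (9/161280)β⁻²}` — the sibling's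
  `eq616_small` with `c_λ = 1/3!`, `c_σ = 1/5!`, `D = 9/161280` from `WilsonAction.norm_VtildeW_le`.
* §4 **(6.16) FOR THE WILSON ACTION AT THE INITIAL SCALE** (`eq616_wilson`): for `β ≥ 1` with `β^{−α} ≤ ϱ₀`,
  `3/8 ≤ α`, `1 < κ`, `0 ≤ p < 1 − κ²/4`, and `ε′` absorbing the lower orders
  (`(1/12 + 1/360)β^{1−4α} + (9/161280)β⁻² ≤ ε′(κ/2)²β^{1−2α}`): for all `x, y` with `|x| ≤ π`, `|y| < (κ/2)β^{−α}`,
  **`|h_W(x + iy)| ≤ exp{(1 + ε′)(κ/2)²β^{1−2α}}`**; and `h_W` is `2π`-periodic in `x` (`WilsonAction.hW_add_pi_eq_sub_pi`),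
  so the bound holds on the whole strip.

**Readings / scope (declared).** (i) This is the member `N = n` (no iteration) of the family of Theorem 2 part 4);
the members `N > n` need Theorem 1 and are not touched. (ii) The absorption condition on `ε′` is kept as the printed
hypothesis («the small ε′ > 0 absorbs contributions of lower order»); it holds for `β` large since `1 − 4α < 1 − 2α`
and `−2 < 1 − 2α`. (iii) `|x| ≤ π` as in Theorem 2 part 3); periodicity (2.11) extends the bound to all `x`.

**Not claimed.** Theorem 2 part 4) itself (normal families: the sibling `Theorem3CommonSubsequence.thm2_part4_normal`
from (6.18)); Theorem 1; anything about lattice Yang–Mills or the Clay problem.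
-/

noncomputable section

open Complex Set Filter
open scoped Real Topology

namespace Literature.MathematicalPhysics.QuantumFieldTheory

namespace MullerSchiemann1987

namespace WilsonStripBound

open NormalFamilyBound (eq616_small eq616_large eq616)
open WilsonAction (norm_VtildeW_le hW_eq_exp_neg_VW)

/-! ## §1 `|h_W(x + iy)| = exp{2β(cos x cosh y − 1)}` -/

/-- Real part of the complex cosine: `Re cos(a + ib) = cos a cosh b`. [folklore] -/
private theorem cos_re_aux (z : ℂ) : (Complex.cos z).re = Real.cos z.re * Real.cosh z.im := by
  rw [Complex.cos_eq]
  simp [Complex.cos_ofReal_re, Complex.cosh_ofReal_re, Complex.sin_ofReal_re, Complex.sinh_ofReal_re,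
    Complex.cos_ofReal_im, Complex.cosh_ofReal_im, Complex.sin_ofReal_im, Complex.sinh_ofReal_im,
    Complex.mul_re, Complex.mul_im]

/-- **`|h_W(x + iy)| = exp{2β(cos x cosh y − 1)}`** (`Re cos(x + iy) = cos x cosh y`). [cite: MullerSchiemann1987,
(2.10) p.264, (2.5) p.264, (6.16) p.281] -/
theorem norm_hW (β x y : ℝ) :
    ‖Complex.exp (2 * (β : ℂ) * (Complex.cos ((x : ℂ) + y * I) - 1))‖ =
      Real.exp (2 * β * (Real.cos x * Real.cosh y - 1)) := by
  rw [Complex.norm_exp]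
  congr 1
  have hre : ((x : ℂ) + y * I).re = x := by simp
  have him : ((x : ℂ) + y * I).im = y := by simp
  have h2 : ((2 : ℂ) * (β : ℂ) * (Complex.cos ((x : ℂ) + y * I) - 1)).re =
      2 * β * ((Complex.cos ((x : ℂ) + y * I)).re - 1) := by
    simp [Complex.mul_re, Complex.sub_re]
  rw [h2, cos_re_aux, hre, him]

/-! ## §2 The large-field regime for (W), directly on the strip `|x| ≤ π` -/

/-- `cosh t − 1 ≤ t²` for `|t| ≤ 1`. [folklore] -/
private theorem cosh_sub_one_le_sq {t : ℝ} (ht : |t| ≤ 1) : Real.cosh t - 1 ≤ t ^ 2 := by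
  have h1 := Real.abs_exp_sub_one_sub_id_le ht
  have h2 := Real.abs_exp_sub_one_sub_id_le (show |-t| ≤ 1 by rwa [abs_neg])
  rw [Real.cosh_eq]
  have := (abs_le.mp h1).2; have := (abs_le.mp h2).2
  nlinarith

/-- `|cosh t − 1 − t²/2| ≤ (5/96)t⁴` for `|t| ≤ 1` (Mathlib's `Real.exp_bound` at order 4). [folklore] -/
private theorem abs_cosh_taylor_le {t : ℝ} (ht : |t| ≤ 1) : |Real.cosh t - 1 - t ^ 2 / 2| ≤ 5 / 96 * t ^ 4 := by
  have h1 := Real.exp_bound ht (show 0 < 4 by norm_num)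
  have h2 := Real.exp_bound (show |-t| ≤ 1 by rwa [abs_neg]) (show 0 < 4 by norm_num)
  have hs : ∀ x : ℝ, ∑ m ∈ Finset.range 4, x ^ m / m.factorial = 1 + x + x ^ 2 / 2 + x ^ 3 / 6 := by
    intro x
    simp only [Finset.sum_range_succ, Finset.sum_range_zero, Nat.factorial]
    norm_num
  rw [hs] at h1 h2
  have hn : ((4:ℕ).succ : ℝ) / ((4:ℕ).factorial * (4:ℕ)) = 5 / 96 := by norm_num [Nat.factorial]
  rw [hn] at h1 h2
  rw [abs_neg] at h2
  have e : Real.cosh t - 1 - t ^ 2 / 2 =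
      ((Real.exp t - (1 + t + t ^ 2 / 2 + t ^ 3 / 6)) + (Real.exp (-t) - (1 + -t + (-t) ^ 2 / 2 + (-t) ^ 3 / 6))) / 2 := by
    rw [Real.cosh_eq]; ring
  rw [e, abs_div, abs_two]
  have := abs_add_le (Real.exp t - (1 + t + t ^ 2 / 2 + t ^ 3 / 6))
    (Real.exp (-t) - (1 + -t + (-t) ^ 2 / 2 + (-t) ^ 3 / 6))
  have h4 : |t| ^ 4 = t ^ 4 := by rw [← abs_pow, abs_of_nonneg (by positivity)]
  rw [h4] at h1 h2
  linarith

/-- `cos 1 ≤ 53/96` (Mathlib's `Real.cos_bound` at `x = 1`). [folklore] -/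
private theorem cos_one_le : Real.cos 1 ≤ 53 / 96 := by
  have h := Real.cos_bound (show |(1:ℝ)| ≤ 1 by norm_num)
  have := (abs_le.mp h).2
  norm_num at this ⊢
  linarith

set_option maxHeartbeats 800000 in -- one long explicit-constant estimate with two regimes (≈ 2–3× the default budget)
/-- **The β-free core of the large-field regime for (W) on the strip**: for `1 < κ`, `0 ≤ p < 1 − κ²/4`,
`0 < ϱ ≤ min(½, (1 − κ²/4 − p)/3)`, `|x| ≤ π`, `|y| < (κ/2)ϱ` and `x² + y² ≥ ϱ²` (i.e. `|x + iy| ≥ ϱ`):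
`2(cos x cosh y − 1) < y² − pϱ²`. Far from `x = 0` (`1 − cos x ≥ δ/2`, `δ := 1 − κ²/4 − p`) the term `−2(1 − cos x)`
wins; near `x = 0`, `|x| < 1` and `1 − cos x ≥ x²/2 − (5/96)x⁴` with `x² ≥ ϱ² − y² > (κ²/4… )` — `p < 1 − κ²/4` is
exactly the room for `y² < (κ²/4)ϱ²`. [cite: MullerSchiemann1987, Thm 2 part 3) p.281, (A₂) p.267, p.268 L.30–31] -/
theorem large_core {κ p ϱ x y : ℝ} (hκ : 1 < κ) (hp : 0 ≤ p) (hδ : p < 1 - κ ^ 2 / 4) (hϱ : 0 < ϱ)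
    (hϱ1 : ϱ ≤ 1 / 2) (hϱ2 : ϱ ≤ (1 - κ ^ 2 / 4 - p) / 3) (hx : |x| ≤ π) (hy : |y| < κ / 2 * ϱ)
    (hfar : ϱ ^ 2 ≤ x ^ 2 + y ^ 2) :
    2 * (Real.cos x * Real.cosh y - 1) < y ^ 2 - p * ϱ ^ 2 := by
  -- constants
  have hδ0 : 0 < 1 - κ ^ 2 / 4 - p := by linarith
  have hκ0 : 0 < κ := by linarith
  have hκ2 : κ < 2 := by nlinarith
  have hκsq : 1 < κ ^ 2 := by nlinarith
  have hp1 : p < 1 := by nlinarith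
  have hy1 : |y| < ϱ := by
    have : κ / 2 * ϱ < 1 * ϱ := mul_lt_mul_of_pos_right (by linarith) hϱ
    linarith
  have hyabs : |y| ≤ 1 := by linarith
  have hy2 : y ^ 2 < κ ^ 2 / 4 * ϱ ^ 2 := by
    have h0 : 0 ≤ κ / 2 * ϱ := by positivity
    have h := mul_self_lt_mul_self (abs_nonneg y) hy
    rw [abs_mul_abs_self] at h
    nlinarith
  have hyϱ : y ^ 2 < ϱ ^ 2 := by
    have h := mul_self_lt_mul_self (abs_nonneg y) hy1
    rw [abs_mul_abs_self] at h
    nlinarith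
  have hϱsq : ϱ ^ 2 ≤ 1 / 4 := by nlinarith
  have hy4 : y ^ 4 ≤ ϱ ^ 2 * ϱ ^ 2 := by
    have e : y ^ 4 = y ^ 2 * y ^ 2 := by ring
    rw [e]
    exact mul_le_mul hyϱ.le hyϱ.le (sq_nonneg _) (sq_nonneg _)
  have hϱ4 : ϱ ^ 2 * ϱ ^ 2 ≤ ϱ ^ 2 / 4 := by nlinarith [sq_nonneg ϱ]
  have hϱδ : ϱ ^ 2 ≤ (1 - κ ^ 2 / 4 - p) / 6 := by nlinarith
  have hpϱ : p * ϱ ^ 2 ≤ ϱ ^ 2 := by nlinarith [sq_nonneg ϱ]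
  -- `d = cosh y − 1`, `s = 1 − cos x`
  have hd0 : 0 ≤ Real.cosh y - 1 := by linarith [Real.one_le_cosh y]
  have hd3 : Real.cosh y - 1 ≤ y ^ 2 / 2 + 5 / 96 * y ^ 4 := by
    have := (abs_le.mp (abs_cosh_taylor_le hyabs)).2; linarith
  have hs0 : 0 ≤ 1 - Real.cos x := by linarith [Real.cos_le_one x]
  have hsd : 0 ≤ (1 - Real.cos x) * (Real.cosh y - 1) := mul_nonneg hs0 hd0
  have hD1 : 1 - κ ^ 2 / 4 - p ≤ 1 := by linarith
  have hϱδ9 : ϱ ^ 2 ≤ (1 - κ ^ 2 / 4 - p) / 9 := by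
    have h1 : ϱ ^ 2 ≤ ((1 - κ ^ 2 / 4 - p) / 3) ^ 2 := pow_le_pow_left₀ hϱ.le hϱ2 2
    have hDD : (1 - κ ^ 2 / 4 - p) * (1 - κ ^ 2 / 4 - p) ≤ (1 - κ ^ 2 / 4 - p) * 1 :=
      mul_le_mul_of_nonneg_left hD1 hδ0.le
    have e : ((1 - κ ^ 2 / 4 - p) / 3) ^ 2 = (1 - κ ^ 2 / 4 - p) * (1 - κ ^ 2 / 4 - p) / 9 := by ring
    rw [e] at h1
    rw [mul_one] at hDD
    exact h1.trans (div_le_div_of_nonneg_right hDD (by norm_num))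
  have H3 : ϱ ^ 2 * ϱ ^ 2 ≤ ϱ ^ 2 * ((1 - κ ^ 2 / 4 - p) / 9) := mul_le_mul_of_nonneg_left hϱδ9 (sq_nonneg ϱ)
  have H4 : 0 < (1 - κ ^ 2 / 4 - p) * ϱ ^ 2 := mul_pos hδ0 (pow_pos hϱ 2)
  have key : 2 * (Real.cos x * Real.cosh y - 1) =
      2 * (Real.cosh y - 1) - 2 * (1 - Real.cos x) - 2 * ((1 - Real.cos x) * (Real.cosh y - 1)) := by ring
  rw [key]
  by_cases hfar' : (1 - κ ^ 2 / 4 - p) / 2 ≤ 1 - Real.cos x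
  · -- far from `x = 0`
    linarith
  · push Not at hfar'
    -- near `x = 0`: first `|x| < 1`
    have hx1 : |x| < 1 := by
      by_contra hx1
      push Not at hx1
      have hc : Real.cos |x| ≤ Real.cos 1 := Real.cos_le_cos_of_nonneg_of_le_pi (by norm_num) hx hx1
      rw [Real.cos_abs] at hc
      linarith [cos_one_le]
    -- `1 − cos x ≥ x²/2 − (5/96)x⁴`
    have hcb := Real.cos_bound hx1.le
    have hx4 : |x| ^ 4 = x ^ 4 := by rw [← abs_pow, abs_of_nonneg (by positivity)]
    rw [hx4] at hcb
    have hs1 : x ^ 2 / 2 - 5 / 96 * x ^ 4 ≤ 1 - Real.cos x := by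
      have := (abs_le.mp hcb).2; linarith
    have hxsq1 : x ^ 2 ≤ 1 := by
      have h := mul_self_le_mul_self (abs_nonneg x) hx1.le
      rw [abs_mul_abs_self] at h; nlinarith
    have hx4le : x ^ 4 ≤ x ^ 2 := by nlinarith [sq_nonneg x]
    -- `x² < (48/43)·(δ/2)·2 = (48/43)δ`… : from `s < δ/2` and `s ≥ (43/96)x²`
    have hxδ : x ^ 2 < 48 / 43 * (1 - κ ^ 2 / 4 - p) := by linarith
    -- `x⁴ ≤ x²·(48/43)δ`
    have hx4δ : x ^ 2 * x ^ 2 ≤ x ^ 2 * (48 / 43 * (1 - κ ^ 2 / 4 - p)) :=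
      mul_le_mul_of_nonneg_left hxδ.le (sq_nonneg x)
    -- `x² > (1 − κ²/4)ϱ²`
    have hxlow : (1 - κ ^ 2 / 4) * ϱ ^ 2 < x ^ 2 := by linarith
    -- `(1 − (5/43)δ)·(1 − κ²/4)ϱ² ≤ (1 − (5/43)δ)·x²`
    have hfac : 0 ≤ 1 - 5 / 43 * (1 - κ ^ 2 / 4 - p) := by linarith
    have H1 : (1 - 5 / 43 * (1 - κ ^ 2 / 4 - p)) * ((1 - κ ^ 2 / 4) * ϱ ^ 2) ≤
        (1 - 5 / 43 * (1 - κ ^ 2 / 4 - p)) * x ^ 2 := mul_le_mul_of_nonneg_left hxlow.le hfac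
    -- `(p + δ)·δϱ² ≤ δϱ²`
    have H2 : (1 - κ ^ 2 / 4) * ((1 - κ ^ 2 / 4 - p) * ϱ ^ 2) ≤ 1 * ((1 - κ ^ 2 / 4 - p) * ϱ ^ 2) :=
      mul_le_mul_of_nonneg_right (by have := sq_nonneg κ; linarith) (mul_nonneg hδ0.le (sq_nonneg ϱ))
    -- `ϱ⁴ ≤ ϱ²·δ/9`
    have hx4' : x ^ 4 = x ^ 2 * x ^ 2 := by ring
    rw [hx4'] at hs1
    clear hcb hx4 hx1 hx key hfar hy hyabs hy1
    linarith [hs1, hx4δ, H1, H2, H3, H4, hd3, hy4, hsd]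

/-- **The large-field regime for (W) on the strip**: for every `β > 0`, `0 < ϱ ≤ ϱ₀`, `|x| ≤ π`, `|y| < (κ/2)ϱ`,
`|x + iy| ≥ ϱ`: `|h_W(x + iy)| < exp{βy² − pβϱ²}`. [cite: MullerSchiemann1987, Thm 2 part 3) p.281, (A₂) p.267] -/
theorem hW_large {κ p : ℝ} (hκ : 1 < κ) (hp : 0 ≤ p) (hδ : p < 1 - κ ^ 2 / 4) {β ϱ : ℝ} (hβ : 0 < β)
    (hϱ : 0 < ϱ) (hϱ0 : ϱ ≤ min (1 / 2) ((1 - κ ^ 2 / 4 - p) / 3)) {x y : ℝ} (hx : |x| ≤ π)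
    (hy : |y| < κ / 2 * ϱ) (hfar : ϱ ^ 2 ≤ x ^ 2 + y ^ 2) :
    ‖Complex.exp (2 * (β : ℂ) * (Complex.cos ((x : ℂ) + y * I) - 1))‖ < Real.exp (β * y ^ 2 - p * β * ϱ ^ 2) := by
  rw [norm_hW, Real.exp_lt_exp]
  have h := large_core hκ hp hδ hϱ (hϱ0.trans (min_le_left _ _)) (hϱ0.trans (min_le_right _ _)) hx hy hfar
  have := mul_lt_mul_of_pos_left h hβ
  linarith

/-! ## §3 The small-field regime for (W): the sibling's `eq616_small` with `c_λ = 1/3!`, `c_σ = 1/5!`,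
`D = 9/161280` -/

/-- `β · (β^{−α})⁸ ≤ β⁻²` for `β ≥ 1`, `α ≥ 3/8`. [folklore] -/
private theorem rpow_bookkeeping {β α : ℝ} (hβ : 1 ≤ β) (hα : 3 / 8 ≤ α) :
    β * (β ^ (-α)) ^ 8 ≤ β ^ (-(2 : ℝ)) := by
  have hβ0 : 0 < β := by linarith
  have h1 : β * (β ^ (-α)) ^ 8 = β ^ (1 - 8 * α) := by
    rw [← Real.rpow_natCast, ← Real.rpow_mul hβ0.le, show (1 - 8 * α) = 1 + (-α * (8 : ℕ)) by push_cast; ring,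
      Real.rpow_add hβ0, Real.rpow_one]
  rw [h1]
  exact Real.rpow_le_rpow_of_exponent_le hβ (by linarith)

/-- **The small-field regime of (6.16) for (W)**: for `β ≥ 1`, `α ≥ 3/8`, `|z| ≤ β^{−α}` and
`(Im z)² ≤ (κ/2)²β^{−2α}`: `|h_W(z)| ≤ exp{(κ/2)²β^{1−2α} + (1/12 + 1/360)β^{1−4α} + (9/161280)β⁻²}` — the sibling's
`eq616_small` fed with (A₃) for the Wilson action (`h_W = e^{−V_W}`, `λ_W = −β/3!`, `σ_W = β/5!`,
`|Ṽ_W| ≤ (9/161280)β|z|⁸ ≤ (9/161280)β⁻²`). [cite: MullerSchiemann1987, (6.16) p.281, Thm 2 part 2) p.281, (A₃) p.267] -/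
theorem hW_small {β α κ : ℝ} (hβ : 1 ≤ β) (hα : 3 / 8 ≤ α) {z : ℂ} (hz : ‖z‖ ≤ β ^ (-α))
    (hy : z.im ^ 2 ≤ (κ / 2) ^ 2 * β ^ (-(2 * α))) :
    ‖Complex.exp (2 * (β : ℂ) * (Complex.cos z - 1))‖ ≤
      Real.exp ((κ / 2) ^ 2 * β ^ (1 - 2 * α) + ((1 / 6) / 2 + (1 / 120) / 3) * β ^ (1 - 4 * α) +
        9 / 161280 * β ^ (-(2 : ℝ))) := by
  have hβ0 : 0 < β := by linarith
  have hρ1 : β ^ (-α) ≤ 1 := Real.rpow_le_one_of_one_le_of_nonpos hβ (by linarith)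
  have hz1 : ‖z‖ ≤ 1 := hz.trans hρ1
  -- (A₃) for (W): the remainder and its bound
  have hVt : ‖2 * (β : ℂ) * (1 - Complex.cos z) -
      ((β : ℂ) * z ^ 2 + (1 / 2) * (-(β : ℂ) / Nat.factorial 3) * z ^ 4 + (1 / 3) * ((β : ℂ) / Nat.factorial 5) * z ^ 6)‖ ≤
      9 / 161280 * β ^ (-(2 : ℝ)) := by
    have h1 := norm_VtildeW_le hβ0.le hz1
    have h2 : ‖z‖ ^ 8 ≤ (β ^ (-α)) ^ 8 := pow_le_pow_left₀ (norm_nonneg _) hz 8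
    have h3 := rpow_bookkeeping hβ hα
    calc _ ≤ 9 / 161280 * β * ‖z‖ ^ 8 := h1
      _ ≤ 9 / 161280 * β * (β ^ (-α)) ^ 8 := by gcongr
      _ = 9 / 161280 * (β * (β ^ (-α)) ^ 8) := by ring
      _ ≤ 9 / 161280 * β ^ (-(2 : ℝ)) := by gcongr
  refine eq616_small (h := Complex.exp (2 * (β : ℂ) * (Complex.cos z - 1)))
    (V := 2 * (β : ℂ) * (1 - Complex.cos z)) (lam := -(β : ℂ) / 6) (sig := (β : ℂ) / 120)
    (Vt := 2 * (β : ℂ) * (1 - Complex.cos z) -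
      ((β : ℂ) * z ^ 2 + (1 / 2) * (-(β : ℂ) / Nat.factorial 3) * z ^ 4 + (1 / 3) * ((β : ℂ) / Nat.factorial 5) * z ^ 6))
    hβ (by linarith) (hW_eq_exp_neg_VW β z) ?_ hVt ?_ ?_ hz hy
  · simp only [Nat.factorial]
    push_cast
    ring
  · rw [norm_div, norm_neg, Complex.norm_real, Real.norm_of_nonneg hβ0.le, Complex.norm_ofNat]
    linarith
  · rw [norm_div, Complex.norm_real, Real.norm_of_nonneg hβ0.le, Complex.norm_ofNat]
    linarith

/-! ## §4 (6.16) for the Wilson action at the initial scale -/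

/-- **(6.16) FOR THE WILSON ACTION AT THE INITIAL SCALE**: for `β ≥ 1` in the weak coupling region
`β^{−α} ≤ ϱ₀ = min(½, (1 − κ²/4 − p)/3)`, `3/8 ≤ α`, `1 < κ`, `0 ≤ p < 1 − κ²/4`, and `ε′` absorbing the lower
orders of the small-field regime — `(1/12 + 1/360)β^{1−4α} + (9/161280)β⁻² ≤ ε′(κ/2)²β^{1−2α}` — every `z = x + iy`
with `|x| ≤ π`, `|y| < (κ/2)β^{−α}` satisfies `|h_W(x + iy)| ≤ exp{(1 + ε′)(κ/2)²β^{1−2α}}`: «It follows directly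
from 2) and 3) of the theorem, the small ε′ > 0 absorbs contributions of lower order in the case 2)».
[cite: MullerSchiemann1987, (6.16) p.281 – p.282 L.2, Thm 2 parts 2)–3) p.281] -/
theorem eq616_wilson {β α κ p ε' : ℝ} (hβ : 1 ≤ β) (hα : 3 / 8 ≤ α) (hκ : 1 < κ) (hp : 0 ≤ p)
    (hδ : p < 1 - κ ^ 2 / 4) (hβα : β ^ (-α) ≤ min (1 / 2) ((1 - κ ^ 2 / 4 - p) / 3))
    (habs : ((1 / 6) / 2 + (1 / 120) / 3) * β ^ (1 - 4 * α) + 9 / 161280 * β ^ (-(2 : ℝ)) ≤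
      ε' * ((κ / 2) ^ 2 * β ^ (1 - 2 * α)))
    {x y : ℝ} (hx : |x| ≤ π) (hy : |y| < κ / 2 * β ^ (-α)) :
    ‖Complex.exp (2 * (β : ℂ) * (Complex.cos ((x : ℂ) + y * I) - 1))‖ ≤
      Real.exp ((1 + ε') * ((κ / 2) ^ 2 * β ^ (1 - 2 * α))) := by
  have hβ0 : 0 < β := by linarith
  have hϱ : 0 < β ^ (-α) := Real.rpow_pos_of_pos hβ0 _
  have hκ0 : 0 < κ := by linarith
  have hrest : 0 ≤ ((1 / 6) / 2 + (1 / 120) / 3) * β ^ (1 - 4 * α) + 9 / 161280 * β ^ (-(2 : ℝ)) := by positivity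
  -- `y² ≤ (κ/2)² β^{−2α}`
  have hy2 : y ^ 2 ≤ (κ / 2) ^ 2 * β ^ (-(2 * α)) := by
    have h0 : 0 ≤ κ / 2 * β ^ (-α) := by positivity
    have h := mul_self_lt_mul_self (abs_nonneg y) hy
    rw [abs_mul_abs_self] at h
    have e : (κ / 2 * β ^ (-α)) * (κ / 2 * β ^ (-α)) = (κ / 2) ^ 2 * β ^ (-(2 * α)) := by
      rw [show -(2 * α) = -α + -α by ring, Real.rpow_add hβ0]; ring
    rw [e] at h
    rw [sq]
    exact h.le
  refine eq616 ?_ hrest habs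
  by_cases hsmall : ‖(x : ℂ) + y * I‖ ≤ β ^ (-α)
  · -- small-field regime
    left
    have him : ((x : ℂ) + y * I).im = y := by simp
    have h := hW_small (κ := κ) hβ hα hsmall (by rw [him]; exact hy2)
    exact h
  · -- large-field regime
    right
    push Not at hsmall
    have hfar : (β ^ (-α)) ^ 2 ≤ x ^ 2 + y ^ 2 := by
      have h1 : (β ^ (-α)) ^ 2 ≤ ‖(x : ℂ) + y * I‖ ^ 2 := pow_le_pow_left₀ hϱ.le hsmall.le 2
      have h2 : ‖(x : ℂ) + y * I‖ ^ 2 = x ^ 2 + y ^ 2 := by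
        rw [← Complex.normSq_eq_norm_sq, Complex.normSq_apply]; simp; ring
      rw [h2] at h1; exact h1
    have h := hW_large hκ hp hδ hβ0 hϱ hβα hx hy hfar
    have e : p * β * (β ^ (-α)) ^ 2 = p * β ^ (1 - 2 * α) := by
      rw [show (1 - 2 * α) = 1 + (-α + -α) by ring, Real.rpow_add hβ0, Real.rpow_add hβ0, Real.rpow_one]; ring
    rw [e] at h
    exact eq616_large hβ0 hp h hy2

end WilsonStripBound

end MullerSchiemann1987

end Literature.MathematicalPhysics.QuantumFieldTheory
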